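import Mathlib
import HarnessLib
import Summits.HubbardSuperconductivity.HubbardSuperconductivity.Theorems.KLProgrammeKLRegimeVolumeLimitRateDoor
import Summits.HubbardSuperconductivity.HubbardSuperconductivity.Theorems.KLProgrammeKLRegimeVolumeLimitCauchyMatsubara
import Summits.HubbardSuperconductivity.HubbardSuperconductivity.Theorems.KLProgrammeKLRegimeSplitBundleV14

/-!
# Route `KLProgramme` — the GEN-5 VL child `VolumeLimitP2 klPredsV14 FinalTwoLegVolLimitEx klWindowC` (re-base of stmt-HubbardSuperconductivity-19858,
# plan g12 (R10) + T4 word 2026-08-27T02:40:03Z): the TWO DOORS of skeleton «cauchy» at the `klPredsV14` tokens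
# (cell gate-hubbard-kl, seat hubbard-kl-k3c4-p1 g4; one-token re-targets of `stub_vl_bound_of_bareFrameBound` (k3c5-p3, `…BoundDoor`)
# and `stub_vl_twoVolumeRate_of_bareFrameRate` (`…RateDoor`))

The re-based skeleton «cauchy» (pre-birth sha16 b24f919cabbcdaf2) states its two stubs with `klPredsV14.frameOK` / `TowerP klPredsV14` in the
hypothesis block.  Neither door uses the tower, and `klPredsV14.frameOK = FrameOK` (`rfl`), so both doors re-target verbatim:

* `stub_vl_bound_of_bareFrameBound_V14` — a bare-frame, spin-`↑` uniform bound beyond own thresholds ⇒ the V14 text of `stub_vl_bound`;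
* `stub_vl_twoVolumeRate_of_bareFrameRate_V14` — a bare-frame uniform bound + two-volume rate ⇒ the V14 text of `stub_vl_twoVolumeRate`;
* `twoVolumeRate_bare_of_split` + `stub_vl_twoVolumeRate_of_bareSplit` / `…_V14` — the THREE-INPUT form of the rate stub's door: (i) a bare
  uniform bound, (ii) a LABEL-UNIFORM cutoff (`M → ∞`) limit of the bare carrier at each volume towards any cutoff-free proxy
  `S∞_L : ℤ → TorusSite 2 L → Fin 2 → ℂ` (the all-`U` lane's output shape), (iii) a two-volume rate of the proxies (the engine's debt) ⇒ the
  registered text (V12 tokens for stmt-19858, V14 tokens for its re-base), via `twoVolumeRate_of_matsubaraLimit` + the door.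

Nothing is asserted about the model.
-/

noncomputable section

namespace Summit.HubbardSuperconductivity.HubbardSuperconductivity.Theorems.KLRegimeSplit

set_option linter.dupNamespace false -- summit = problem name (single-conjunct summit), D-0017

open Filter Topology Finset Real Literature.MathematicalPhysics.QuantumLattice Literature.Probability.LatticeModels
open Literature.MathematicalPhysics.QuantumLattice.FermiRG
open Summit.HubbardSuperconductivity.HubbardSuperconductivity.Theorems.KLProgrammeLegKernels
open Summit.HubbardSuperconductivity.HubbardSuperconductivity.Theorems.TwoPointAssembly

/-- **THE DOOR FOR `stub_vl_bound` AT `klPredsV14`** (k3c5-p3's `stub_vl_bound_of_bareFrameBound`, re-targeted): a bare-frame, spin-`↑`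
uniform bound beyond own thresholds for every `β > 0`, `U`, `μ` gives the V14 stub text verbatim. -/
theorem stub_vl_bound_of_bareFrameBound_V14
    (hbare : ∀ β : ℝ, 0 < β → ∀ U μ : ℝ, ∃ B₀ : ℝ, ∃ L₀ : ℕ, ∃ Mth : ℕ → ℕ,
      ∀ (L : ℕ) [NeZero L], L₀ ≤ L → ∀ (M : ℕ) [NeZero M], Mth L ≤ M →
        ∀ k : FreqMomentum L M, ‖klSelfEnergy L M β U μ 0 klE0 (nScales β + 1) k 0‖ ≤ B₀) :
    ∀ (G : GeoConsts) (P : SplitConsts) (Q : EngConsts) (R : RenConsts), G.WF → P.WF → Q.WF → R.WF →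
      ∃ c₅ : ℝ, 0 < c₅ ∧ ∀ c : ℝ, 0 < c → c ≤ c₅ → ∃ U₀ : ℝ, 0 < U₀ ∧
        ∀ μ ∈ klWindowC, ∀ U : ℝ, 0 < U → U ≤ U₀ → ∀ β : ℝ, klBetaMin ≤ β → β ≤ Real.exp (c / U ^ 2) →
          ∀ K : TrigPolyC4v, klPredsV14.frameOK R U (nScales β) μ K →
            ∀ (Lstar : ℕ) (Mstar : ℕ → ℕ), TowerP klPredsV14 G P Q R β U μ K Lstar Mstar →
              ∃ B : ℝ, ∃ L₀ : ℕ, ∃ Mth : ℕ → ℕ, ∀ (L : ℕ) [NeZero L], L₀ ≤ L → ∀ (M : ℕ) [NeZero M], Mth L ≤ M →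
                ∀ (k : FreqMomentum L M) (σ : Fin 2), ‖klSelfEnergy L M β U μ K klE0 (nScales β + 1) k σ‖ ≤ B := by
  intro G P Q R _ _ _ _
  refine ⟨1, one_pos, fun c _ _ => ⟨1, one_pos, ?_⟩⟩
  intro μ _ U _ _ β hβmin _ K _ Lstar Mstar _
  have hβ : 0 < β := pos_of_klBetaMin_le hβmin
  obtain ⟨B₀, L₀, Mth, h0⟩ := hbare β hβ U μ
  have h0' : ∀ (L : ℕ) [NeZero L], L₀ ≤ L → ∀ (M : ℕ) [NeZero M], Mth L ≤ M →
      ∀ (k : FreqMomentum L M) (σ : Fin 2), ‖klSelfEnergy L M β U μ 0 klE0 (nScales β + 1) k σ‖ ≤ B₀ := by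
    intro L _ hL M _ hM k σ
    rw [klSelfEnergy_nScales_succ_spin_eq]
    exact h0 L hL M hM k
  exact ⟨_, L₀, Mth, uniformBound_frame_transfer hβ U μ K 0 h0'⟩

/-- **THE DOOR FOR `stub_vl_twoVolumeRate` AT `klPredsV14`** (`stub_vl_twoVolumeRate_of_bareFrameRate`, re-targeted): a bare-frame uniform
bound and two-volume rate with cross-grid modulus beyond own thresholds for every `β > 0`, `U`, `μ` give the V14 stub text verbatim. -/
theorem stub_vl_twoVolumeRate_of_bareFrameRate_V14
    (hbare : ∀ β : ℝ, 0 < β → ∀ U μ : ℝ, ∃ B₀ : ℝ, ∃ L₀ : ℕ, ∃ Mth : ℕ → ℕ, ∃ D : ℝ, ∃ ρ : ℕ → ℝ, Tendsto ρ atTop (𝓝 0) ∧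
      (∀ (L : ℕ) [NeZero L], L₀ ≤ L → ∀ (M : ℕ) [NeZero M], Mth L ≤ M →
        ∀ (k : FreqMomentum L M) (σ : Fin 2), ‖klSelfEnergy L M β U μ 0 klE0 (nScales β + 1) k σ‖ ≤ B₀) ∧
      (∀ (L : ℕ) [NeZero L], L₀ ≤ L → ∀ (M : ℕ) [NeZero M], Mth L ≤ M →
        ∀ (L' : ℕ) [NeZero L'], L ≤ L' → ∀ (M' : ℕ) [NeZero M'], Mth L' ≤ M' →
          ∀ (σ : Fin 2) (ω : MatsubaraIdx M) (ω' : MatsubaraIdx M'), matsubaraInt M ω = matsubaraInt M' ω' →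
            ∀ (k : TorusSite 2 L) (k' : TorusSite 2 L'),
              ‖klSelfEnergy L M β U μ 0 klE0 (nScales β + 1) (ω, k) σ - klSelfEnergy L' M' β U μ 0 klE0 (nScales β + 1) (ω', k') σ‖ ≤
                ρ L + D * ∑ i, torusAbs (latticeMomentum L k i - latticeMomentum L' k' i))) :
    ∀ (G : GeoConsts) (P : SplitConsts) (Q : EngConsts) (R : RenConsts), G.WF → P.WF → Q.WF → R.WF →
      ∃ c₅ : ℝ, 0 < c₅ ∧ ∀ c : ℝ, 0 < c → c ≤ c₅ → ∃ U₀ : ℝ, 0 < U₀ ∧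
        ∀ μ ∈ klWindowC, ∀ U : ℝ, 0 < U → U ≤ U₀ → ∀ β : ℝ, klBetaMin ≤ β → β ≤ Real.exp (c / U ^ 2) →
          ∀ K : TrigPolyC4v, klPredsV14.frameOK R U (nScales β) μ K →
            ∀ (Lstar : ℕ) (Mstar : ℕ → ℕ), TowerP klPredsV14 G P Q R β U μ K Lstar Mstar →
              ∃ L₀ : ℕ, ∃ Mth : ℕ → ℕ, ∃ D : ℝ, ∃ ρ : ℕ → ℝ, Tendsto ρ atTop (𝓝 0) ∧
                ∀ (L : ℕ) [NeZero L], L₀ ≤ L → ∀ (M : ℕ) [NeZero M], Mth L ≤ M →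
                  ∀ (L' : ℕ) [NeZero L'], L ≤ L' → ∀ (M' : ℕ) [NeZero M'], Mth L' ≤ M' →
                    ∀ (σ : Fin 2) (ω : MatsubaraIdx M) (ω' : MatsubaraIdx M'), matsubaraInt M ω = matsubaraInt M' ω' →
                      ∀ (k : TorusSite 2 L) (k' : TorusSite 2 L'),
                        ‖klSelfEnergy L M β U μ K klE0 (nScales β + 1) (ω, k) σ -
                            klSelfEnergy L' M' β U μ K klE0 (nScales β + 1) (ω', k') σ‖ ≤
                          ρ L + D * ∑ i, torusAbs (latticeMomentum L k i - latticeMomentum L' k' i) := by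
  intro G P Q R _ _ _ _
  refine ⟨1, one_pos, fun c _ _ => ⟨1, one_pos, ?_⟩⟩
  intro μ _ U _ _ β hβmin _ K hK Lstar Mstar _
  have hβ : 0 < β := pos_of_klBetaMin_le hβmin
  obtain ⟨B₀, L₀, Mth, D, ρ, hρ, hb, hr⟩ := hbare β hβ U μ
  exact twoVolumeRate_frame_transfer_of_bare hβ U μ hK hb ⟨D, ρ, hρ, hr⟩

/-! ## The three-input form: bound + label-uniform cutoff limit + two-volume rate of the cutoff-free proxies -/

/-- **Bare two-volume data from the split inputs**: a bare uniform bound beyond `(L₀, Mth)`, a label-uniform cutoff limit towards proxies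
`S∞_L` at every `L ≥ L₀`, and a two-volume rate of the proxies give the bare bound AND the bare two-volume rate beyond COMMON thresholds
(the hypothesis pair of `twoVolumeRate_frame_transfer_of_bare` / of the doors). -/
theorem twoVolumeRate_bare_of_split {β U μ : ℝ} {B₀ : ℝ} {L₀ : ℕ} {Mth : ℕ → ℕ}
    {Sinf : ∀ (L : ℕ) [NeZero L], ℤ → TorusSite 2 L → Fin 2 → ℂ} {D : ℝ} {ρ : ℕ → ℝ} (hρ : Tendsto ρ atTop (𝓝 0))
    (hb : ∀ (L : ℕ) [NeZero L], L₀ ≤ L → ∀ (M : ℕ) [NeZero M], Mth L ≤ M →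
      ∀ (k : FreqMomentum L M) (σ : Fin 2), ‖klSelfEnergy L M β U μ 0 klE0 (nScales β + 1) k σ‖ ≤ B₀)
    (hcut : ∀ (L : ℕ) [NeZero L], L₀ ≤ L → ∀ ε : ℝ, 0 < ε → ∃ M₁ : ℕ, ∀ (M : ℕ) [NeZero M], M₁ ≤ M →
      ∀ (ω : MatsubaraIdx M) (k : TorusSite 2 L) (σ : Fin 2),
        ‖klSelfEnergy L M β U μ 0 klE0 (nScales β + 1) (ω, k) σ - Sinf L (matsubaraInt M ω) k σ‖ ≤ ε)
    (hvol : ∀ (L : ℕ) [NeZero L], L₀ ≤ L → ∀ (L' : ℕ) [NeZero L'], L ≤ L' →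
      ∀ (n : ℤ) (σ : Fin 2) (k : TorusSite 2 L) (k' : TorusSite 2 L'),
        ‖Sinf L n k σ - Sinf L' n k' σ‖ ≤ ρ L + D * ∑ i, torusAbs (latticeMomentum L k i - latticeMomentum L' k' i)) :
    ∃ Mth' : ℕ → ℕ, ∃ D' : ℝ, ∃ ρ' : ℕ → ℝ, Tendsto ρ' atTop (𝓝 0) ∧
      (∀ (L : ℕ) [NeZero L], L₀ ≤ L → ∀ (M : ℕ) [NeZero M], Mth' L ≤ M →
        ∀ (k : FreqMomentum L M) (σ : Fin 2), ‖klSelfEnergy L M β U μ 0 klE0 (nScales β + 1) k σ‖ ≤ B₀) ∧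
      (∀ (L : ℕ) [NeZero L], L₀ ≤ L → ∀ (M : ℕ) [NeZero M], Mth' L ≤ M →
        ∀ (L' : ℕ) [NeZero L'], L ≤ L' → ∀ (M' : ℕ) [NeZero M'], Mth' L' ≤ M' →
          ∀ (σ : Fin 2) (ω : MatsubaraIdx M) (ω' : MatsubaraIdx M'), matsubaraInt M ω = matsubaraInt M' ω' →
            ∀ (k : TorusSite 2 L) (k' : TorusSite 2 L'),
              ‖klSelfEnergy L M β U μ 0 klE0 (nScales β + 1) (ω, k) σ - klSelfEnergy L' M' β U μ 0 klE0 (nScales β + 1) (ω', k') σ‖ ≤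
                ρ' L + D' * ∑ i, torusAbs (latticeMomentum L k i - latticeMomentum L' k' i)) := by
  obtain ⟨Mth₁, ρ', hρ', hrate⟩ := twoVolumeRate_of_matsubaraLimit
    (S := fun L M _ _ k σ => klSelfEnergy L M β U μ 0 klE0 (nScales β + 1) k σ) (Sinf := Sinf) hρ hcut hvol
  refine ⟨fun L => max (Mth L) (Mth₁ L), D, ρ', hρ', fun L _ hL M _ hM k σ => hb L hL M (le_of_max_le_left hM) k σ, ?_⟩
  intro L _ hL M _ hM L' _ hLL' M' _ hM' σ ω ω' hωω' k k'
  exact hrate L hL M (le_of_max_le_right hM) L' hLL' M' (le_of_max_le_right hM') σ ω ω' hωω' k k'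

/-- **THE THREE-INPUT DOOR for `stub_vl_twoVolumeRate` of stmt-19858 (V12 tokens).** -/
theorem stub_vl_twoVolumeRate_of_bareSplit
    (hsplit : ∀ β : ℝ, 0 < β → ∀ U μ : ℝ, ∃ B₀ : ℝ, ∃ L₀ : ℕ, ∃ Mth : ℕ → ℕ,
      ∃ Sinf : ∀ (L : ℕ) [NeZero L], ℤ → TorusSite 2 L → Fin 2 → ℂ, ∃ D : ℝ, ∃ ρ : ℕ → ℝ, Tendsto ρ atTop (𝓝 0) ∧
      (∀ (L : ℕ) [NeZero L], L₀ ≤ L → ∀ (M : ℕ) [NeZero M], Mth L ≤ M →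
        ∀ (k : FreqMomentum L M) (σ : Fin 2), ‖klSelfEnergy L M β U μ 0 klE0 (nScales β + 1) k σ‖ ≤ B₀) ∧
      (∀ (L : ℕ) [NeZero L], L₀ ≤ L → ∀ ε : ℝ, 0 < ε → ∃ M₁ : ℕ, ∀ (M : ℕ) [NeZero M], M₁ ≤ M →
        ∀ (ω : MatsubaraIdx M) (k : TorusSite 2 L) (σ : Fin 2),
          ‖klSelfEnergy L M β U μ 0 klE0 (nScales β + 1) (ω, k) σ - Sinf L (matsubaraInt M ω) k σ‖ ≤ ε) ∧
      (∀ (L : ℕ) [NeZero L], L₀ ≤ L → ∀ (L' : ℕ) [NeZero L'], L ≤ L' →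
        ∀ (n : ℤ) (σ : Fin 2) (k : TorusSite 2 L) (k' : TorusSite 2 L'),
          ‖Sinf L n k σ - Sinf L' n k' σ‖ ≤ ρ L + D * ∑ i, torusAbs (latticeMomentum L k i - latticeMomentum L' k' i))) :
    ∀ (G : GeoConsts) (P : SplitConsts) (Q : EngConsts) (R : RenConsts), G.WF → P.WF → Q.WF → R.WF →
      ∃ c₅ : ℝ, 0 < c₅ ∧ ∀ c : ℝ, 0 < c → c ≤ c₅ → ∃ U₀ : ℝ, 0 < U₀ ∧
        ∀ μ ∈ klWindowC, ∀ U : ℝ, 0 < U → U ≤ U₀ → ∀ β : ℝ, klBetaMin ≤ β → β ≤ Real.exp (c / U ^ 2) →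
          ∀ K : TrigPolyC4v, klPredsV12.frameOK R U (nScales β) μ K →
            ∀ (Lstar : ℕ) (Mstar : ℕ → ℕ), TowerP klPredsV12 G P Q R β U μ K Lstar Mstar →
              ∃ L₀ : ℕ, ∃ Mth : ℕ → ℕ, ∃ D : ℝ, ∃ ρ : ℕ → ℝ, Tendsto ρ atTop (𝓝 0) ∧
                ∀ (L : ℕ) [NeZero L], L₀ ≤ L → ∀ (M : ℕ) [NeZero M], Mth L ≤ M →
                  ∀ (L' : ℕ) [NeZero L'], L ≤ L' → ∀ (M' : ℕ) [NeZero M'], Mth L' ≤ M' →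
                    ∀ (σ : Fin 2) (ω : MatsubaraIdx M) (ω' : MatsubaraIdx M'), matsubaraInt M ω = matsubaraInt M' ω' →
                      ∀ (k : TorusSite 2 L) (k' : TorusSite 2 L'),
                        ‖klSelfEnergy L M β U μ K klE0 (nScales β + 1) (ω, k) σ -
                            klSelfEnergy L' M' β U μ K klE0 (nScales β + 1) (ω', k') σ‖ ≤
                          ρ L + D * ∑ i, torusAbs (latticeMomentum L k i - latticeMomentum L' k' i) := by
  refine stub_vl_twoVolumeRate_of_bareFrameRate fun β hβ U μ => ?_
  obtain ⟨B₀, L₀, Mth, Sinf, D, ρ, hρ, hb, hcut, hvol⟩ := hsplit β hβ U μ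
  obtain ⟨Mth', D', ρ', hρ', hb', hr'⟩ := twoVolumeRate_bare_of_split hρ hb hcut hvol
  exact ⟨B₀, L₀, Mth', D', ρ', hρ', hb', hr'⟩

/-- **THE THREE-INPUT DOOR for `stub_vl_twoVolumeRate` at `klPredsV14`** (gen-5 re-base of stmt-19858). -/
theorem stub_vl_twoVolumeRate_of_bareSplit_V14
    (hsplit : ∀ β : ℝ, 0 < β → ∀ U μ : ℝ, ∃ B₀ : ℝ, ∃ L₀ : ℕ, ∃ Mth : ℕ → ℕ,
      ∃ Sinf : ∀ (L : ℕ) [NeZero L], ℤ → TorusSite 2 L → Fin 2 → ℂ, ∃ D : ℝ, ∃ ρ : ℕ → ℝ, Tendsto ρ atTop (𝓝 0) ∧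
      (∀ (L : ℕ) [NeZero L], L₀ ≤ L → ∀ (M : ℕ) [NeZero M], Mth L ≤ M →
        ∀ (k : FreqMomentum L M) (σ : Fin 2), ‖klSelfEnergy L M β U μ 0 klE0 (nScales β + 1) k σ‖ ≤ B₀) ∧
      (∀ (L : ℕ) [NeZero L], L₀ ≤ L → ∀ ε : ℝ, 0 < ε → ∃ M₁ : ℕ, ∀ (M : ℕ) [NeZero M], M₁ ≤ M →
        ∀ (ω : MatsubaraIdx M) (k : TorusSite 2 L) (σ : Fin 2),
          ‖klSelfEnergy L M β U μ 0 klE0 (nScales β + 1) (ω, k) σ - Sinf L (matsubaraInt M ω) k σ‖ ≤ ε) ∧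
      (∀ (L : ℕ) [NeZero L], L₀ ≤ L → ∀ (L' : ℕ) [NeZero L'], L ≤ L' →
        ∀ (n : ℤ) (σ : Fin 2) (k : TorusSite 2 L) (k' : TorusSite 2 L'),
          ‖Sinf L n k σ - Sinf L' n k' σ‖ ≤ ρ L + D * ∑ i, torusAbs (latticeMomentum L k i - latticeMomentum L' k' i))) :
    ∀ (G : GeoConsts) (P : SplitConsts) (Q : EngConsts) (R : RenConsts), G.WF → P.WF → Q.WF → R.WF →
      ∃ c₅ : ℝ, 0 < c₅ ∧ ∀ c : ℝ, 0 < c → c ≤ c₅ → ∃ U₀ : ℝ, 0 < U₀ ∧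
        ∀ μ ∈ klWindowC, ∀ U : ℝ, 0 < U → U ≤ U₀ → ∀ β : ℝ, klBetaMin ≤ β → β ≤ Real.exp (c / U ^ 2) →
          ∀ K : TrigPolyC4v, klPredsV14.frameOK R U (nScales β) μ K →
            ∀ (Lstar : ℕ) (Mstar : ℕ → ℕ), TowerP klPredsV14 G P Q R β U μ K Lstar Mstar →
              ∃ L₀ : ℕ, ∃ Mth : ℕ → ℕ, ∃ D : ℝ, ∃ ρ : ℕ → ℝ, Tendsto ρ atTop (𝓝 0) ∧
                ∀ (L : ℕ) [NeZero L], L₀ ≤ L → ∀ (M : ℕ) [NeZero M], Mth L ≤ M →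
                  ∀ (L' : ℕ) [NeZero L'], L ≤ L' → ∀ (M' : ℕ) [NeZero M'], Mth L' ≤ M' →
                    ∀ (σ : Fin 2) (ω : MatsubaraIdx M) (ω' : MatsubaraIdx M'), matsubaraInt M ω = matsubaraInt M' ω' →
                      ∀ (k : TorusSite 2 L) (k' : TorusSite 2 L'),
                        ‖klSelfEnergy L M β U μ K klE0 (nScales β + 1) (ω, k) σ -
                            klSelfEnergy L' M' β U μ K klE0 (nScales β + 1) (ω', k') σ‖ ≤
                          ρ L + D * ∑ i, torusAbs (latticeMomentum L k i - latticeMomentum L' k' i) := by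
  refine stub_vl_twoVolumeRate_of_bareFrameRate_V14 fun β hβ U μ => ?_
  obtain ⟨B₀, L₀, Mth, Sinf, D, ρ, hρ, hb, hcut, hvol⟩ := hsplit β hβ U μ
  obtain ⟨Mth', D', ρ', hρ', hb', hr'⟩ := twoVolumeRate_bare_of_split hρ hb hcut hvol
  exact ⟨B₀, L₀, Mth', D', ρ', hρ', hb', hr'⟩

end Summit.HubbardSuperconductivity.HubbardSuperconductivity.Theorems.KLRegimeSplit

end
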